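import Literature.AlgebraicGeometry.Motives.GrassmannianChartColumns
import Mathlib.Algebra.MvPolynomial.CommRing
import Mathlib.Algebra.MvPolynomial.Eval
import HarnessLib

/-!
# The universal point of the standard chart (objects): `coordMapOfColumns`, `univCoordMap`, `univChart`

Topic `Literature/AlgebraicGeometry/Motives`; namespace `Literature.AlgebraicGeometry.Motives`, prefix `Grassmannian.`.  Sequel to
`GrassmannianChartColumns`; cell hodgecm-mathlib key (h4) (author B-p21 (g15), partner B-p18 (g17)), the ring side of the (A3) step
«`f_x : yoneda.obj 𝔸 ⟶ Gr` from the universal chart element» (B-p21 (g15) / B-p09 (g12)).  DEFINITIONS ONLY (non-Prop plumbing);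
their theory (frame/columns lemmas, naturality, evaluation, the universal property) is the PROOF-lane sequel
`GrassmannianChartUniversalProperty`.  No instance, no notation, no `sorry`.

Fix a free `R`-module `M` with basis `b : J → M`, `I : Fin k → J` injective, `σ := {j // j ∉ range I}` and the polynomial ring
`P := R[X_{(j,i)} : (j,i) ∈ σ × Fin k]` (`MvPolynomial (σ × Fin k) R`).

* `Grassmannian.coordMapOfColumns b I v : M →ₗ[R] Aᵏ` — THE coordinate map with `I`-columns the identity and free columns `v : σ → Aᵏ`
  (explicit inverse of ★ `bijective_restrictColumns`);
* `Grassmannian.univCoordMap b I : M →ₗ[R] Pᵏ` — free columns the variables `X_{(j,i)}`;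
* **`Grassmannian.univChart b I hI : G(k, P ⊗ M; P)`** — THE UNIVERSAL POINT OF THE CHART `U_I` (★ `ofCoordMap` of `univCoordMap`):
  `U_I ≅ Hom_R(P, −) = 𝔸^{k · #σ}` with universal element `univChart` ([Stacks 089T]; EGA I 9.7.4; [EisenbudHarris2016, §3.2.2]).

HC_CM is proved only modulo the 7 printed citations until rung 0 closes; nothing here is about HC.

## References
* [StacksProject, Tag 089T]; A. Grothendieck, EGA I (Springer 1971), §9.7.4; [EisenbudHarris2016, §3.2.2].
-/

noncomputable section

universe u v w

open TensorProduct

namespace Literature.AlgebraicGeometry.Motives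

namespace Grassmannian

variable {R : Type u} [CommRing R] {M : Type v} [AddCommGroup M] [Module R M] {k : ℕ} {J : Type v}
variable {A : Type w} [CommRing A] [Algebra R A]

/-- **The coordinate map with `I`-columns the identity and free columns `v`**: the `R`-linear map `M → Aᵏ` with `b_{I i} ↦ eᵢ` and
`b_j ↦ v j` for `j ∉ range I` (Mathlib `Module.Basis.constr`; non-Prop plumbing, the explicit inverse of ★ `bijective_restrictColumns`).
[cite: EisenbudHarris2016, §3.2.2] -/
def coordMapOfColumns (b : Module.Basis J R M) (I : Fin k → J) (v : {j : J // j ∉ Set.range I} → (Fin k → A)) :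
    M →ₗ[R] (Fin k → A) :=
  b.constr R fun j =>
    haveI : Decidable (∃ i, I i = j) := Classical.dec _
    if h : ∃ i, I i = j then Pi.single h.choose 1 else v ⟨j, fun hj => h (Set.mem_range.1 hj)⟩

/-- **The universal coordinate map** over `P = R[X_{(j,i)}]`: free columns the variables, `b_j ↦ (X_{(j,i)})_i` for `j ∉ range I`.
[cite: StacksProject, Tag 089T] -/
def univCoordMap (b : Module.Basis J R M) (I : Fin k → J) :
    M →ₗ[R] (Fin k → MvPolynomial ({j : J // j ∉ Set.range I} × Fin k) R) :=
  coordMapOfColumns b I fun j i => MvPolynomial.X (j, i)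

/-- **THE UNIVERSAL POINT OF THE CHART `U_I`**: `univChart := N_{ψ_univ} ∈ G(k, P ⊗ M; P)`, the chart point of the universal
coordinate map (★ `ofCoordMap`; the frame normalisation `ψ_univ(b_{I i}) = eᵢ` is checked inline, `I` injective).
[cite: StacksProject, Tag 089T] [cite: EisenbudHarris2016, §3.2.2] -/
def univChart (b : Module.Basis J R M) (I : Fin k → J) (hI : Function.Injective I) :
    Module.Grassmannian (MvPolynomial ({j : J // j ∉ Set.range I} × Fin k) R)
      (MvPolynomial ({j : J // j ∉ Set.range I} × Fin k) R ⊗[R] M) k :=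
  ofCoordMap (⇑b ∘ I) (univCoordMap b I) fun i =>
    -- term-mode check of `ψ_univ (b (I i)) = eᵢ`: `constr_basis`, then the `dite` takes its positive branch, and `I` is injective
    (Module.Basis.constr_basis b R _ (I i)).trans
      ((dif_pos (⟨i, rfl⟩ : ∃ i', I i' = I i)).trans
        (congrArg (fun i' : Fin k => (Pi.single i' 1 : Fin k → MvPolynomial ({j : J // j ∉ Set.range I} × Fin k) R))
          (hI (Exists.choose_spec (⟨i, rfl⟩ : ∃ i', I i' = I i)))))

end Grassmannian

end Literature.AlgebraicGeometry.Motives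

end
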